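import Literature.AlgebraicGeometry.Morphisms.ProjectiveFrameLocusLinearInvariance
import Literature.AlgebraicGeometry.Motives.GeneratingSectionsToProjRatios
import Literature.AlgebraicGeometry.Motives.GeneratingSectionsOfLineBundle
import HarnessLib

/-!
# A linear change of generating sections moves the morphism to `𝐏ⁿ_ℤ` by the matrix

Topic `Literature/AlgebraicGeometry/Motives`; namespace `Literature.AlgebraicGeometry.Motives.GeneratingSections`.
THEOREMS ONLY (no definition, no instance, no notation, no named fact, no `sorry`; `set_option
backward.isDefEq.respectTransparency false` as in the tree's action files).

[Hartshorne1977] II Thm. 7.1: a morphism `X → 𝐏ⁿ` is the same as a line bundle `𝓛` with generating sections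
`s_0, …, s_n` (up to a unit); II Example 7.1.1 (p. 151): an invertible matrix `‖a_{ij}‖` acts on `𝐏ⁿ` by
`x'_i = Σ_j a_{ij} x_j`.  Hence **replacing the sections by `s'_i = Σ_j a_{ij} s_j` replaces the morphism `[s]` by
`a • [s]`**.  In the tree's currencies — generating-sections data `GeneratingSections` / `toProj` (★
`Motives/MorphismsToProjectiveSpace`), cocycle presentations `CocycleSections` / `ofCocycleSections` (★
`Motives/GeneratingSectionsOfCocycle`), frame systems `CocycleSections.ofFrameSystem` (★ `Motives/GeneratingSectionsOfLineBundle`),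
and the `S`-free acted point `M • q := ⟨X → Spec Γ(X,𝒪_X), q⟩ ≫ actCore M` of `M ∈ GL_{n+1}(Γ(X, 𝒪_X))` (★
`GroupSchemes/GeneralLinearGroupActionUniversalPoint`, ★ `Morphisms/ProjectiveFrameLocusLinearInvariance`):

* §1 **`ι_comp_eq_ι_comp_lift_actCore_of_chart`** — one chart: over an open `V`, if `q|_V ∈ D₊(x_a)` has coordinates
  `θ`, `(M|_V θ)_b` is a unit and `q'|_V ∈ D₊(x_b)` has coordinates `θ'` with `θ'_i · (M|_V θ)_b = (M|_V θ)_i`, then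
  `q'|_V = (M • q)|_V` (★ `lift_actCore_eq_coordPoint`, ★ `eq_coordPoint_int`, ★ `coordPoint_smul`);
* §2 **`toProj_eq_lift_actCore_toProj`** — generating-sections data `D`, `D'` whose ratios are related by `M`
  (`(s'_i/s'_b) · (s'_b/s_a) = s'_i/s_a` with `s'_j/s_a := Σ_k M_{jk} · s_k/s_a`) have `toProj D' = M • toProj D`
  (equality of morphisms is local: on `U a ∩ U' b` both lie in `D₊(x_b)`, ★ `homRatio_toProj`);
* §3 **`toProj_ofCocycleSections_eq_lift_actCore_of_coeff`** — cocycle form: coefficients on common trivialising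
  opens related by `c' j x = Σ_k M_{jk}|_{W x} · c k x` (local formula ★ `ofCocycleSections_ratio_res_mul`);
* §4 **`toProj_ofFrameSystem_eq_lift_actCore_of_eq_sum_smul`** — line-bundle form: sections `t'_j = Σ_k M_{jk} • t_k`
  of a module with a rank-one frame system (coordinates are `𝒪_X`-linear, `coeffAt_eq_sum_of_eq_sum_smul`).

Cell hodgecm-mathlib (D-0151), F-8 REOPENED (director s231): the generic brick (U-a) under (8γ-U) «two linear
rigidifications differ by `GL_{m+1}`» (B-p01 (g14)) and «LR-ACT» (B-p07 (g18)).  Count-neutral Mathlib-side capital: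
HC_CM is proved only modulo the 7 printed citations until rung 0 closes — nothing here is about HC.

## References
* [Hartshorne1977] R. Hartshorne, *Algebraic Geometry* (1977): II Thm. 7.1 (p. 150), II Example 7.1.1 (p. 151).
* [GortzWedhorn2020] U. Görtz, T. Wedhorn, *Algebraic Geometry I: Schemes*, 2nd ed. (2020): Definition 4.44 (p. 117).
-/

noncomputable section

set_option backward.isDefEq.respectTransparency false

universe v u

open CategoryTheory CategoryTheory.Limits AlgebraicGeometry Matrix HomogeneousLocalization TopologicalSpace
open MvPolynomial (X)
open Literature.AlgebraicGeometry.Morphisms (intU projectiveSpaceInt isPullback_projToSpec_projMap_terminal)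
open Literature.AlgebraicGeometry.Morphisms.ProjFrame (coordPoint coordPoint_smul coordPoint_congr preU_coordPoint
  rs_homRatio_coordPoint comp_lift_actCore lift_actCore_eq_coordPoint preU_lift_actCore rs_homRatio_lift_actCore)
open Literature.AlgebraicGeometry.GroupSchemes.GeneralLinearGroupScheme (intCast actCore eq_coordPoint_int)

namespace Literature.AlgebraicGeometry.Motives.GeneratingSections

variable (I : Type u) {X : Scheme.{u}}
  (D D' : GeneratingSections (Fin (Nat.card I + 1)) X) (M : GL (Fin (Nat.card I + 1)) Γ(X, ⊤))

/-! ### §1 One chart: two points of `𝐏ⁿ_ℤ` over an open, the second with the `M`-moved coordinates of the first -/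

section Chart

variable {V : X.Opens} (q q' : X ⟶ projectiveSpaceInt I) (a b : Fin (Nat.card I + 1))

/-- **One-chart recognition of the acted point.**  Over an open `V ⊆ X`, let `q|_V` land in the chart `D₊(x_a)`
with coordinate vector `θ` (`θ_a` a unit) and let `(M|_V θ)_b` be a unit; if `q'|_V` lands in `D₊(x_b)` with
coordinates `θ'_i` satisfying `θ'_i · (M|_V θ)_b = (M|_V θ)_i`, then `q'|_V = (M • q)|_V` — both are the point with
homogeneous coordinates `M|_V θ` (★ `lift_actCore_eq_coordPoint`, ★ `eq_coordPoint_int`, ★ `coordPoint_smul`).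
[cite: Hartshorne1977, II Thm. 7.1 (b)] [cite: GortzWedhorn2020, Definition 4.44 (p. 117)] -/
theorem ι_comp_eq_ι_comp_lift_actCore_of_chart (θ : Fin (Nat.card I + 1) → Γ(↑V, ⊤))
    (ha : preU (V.ι ≫ q) a = ⊤) (hθ : ∀ i, rs ha.ge (homRatio (V.ι ≫ q) a i) = θ i) (hθa : IsUnit (θ a))
    (hb : IsUnit (((Matrix.GeneralLinearGroup.map V.ι.appTop.hom M : Matrix _ _ Γ(↑V, ⊤)) *ᵥ θ) b))
    (hb' : preU (V.ι ≫ q') b = ⊤)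
    (hθ' : ∀ i, rs hb'.ge (homRatio (V.ι ≫ q') b i) *
        ((Matrix.GeneralLinearGroup.map V.ι.appTop.hom M : Matrix _ _ Γ(↑V, ⊤)) *ᵥ θ) b =
      ((Matrix.GeneralLinearGroup.map V.ι.appTop.hom M : Matrix _ _ Γ(↑V, ⊤)) *ᵥ θ) i) :
    letI : Algebra intU.{u} Γ(X, ⊤) := (intCast _).toAlgebra
    V.ι ≫ q' =
      V.ι ≫ ((isPullback_projToSpec_projMap_terminal I Γ(X, ⊤)).lift X.toSpecΓ q (terminal.hom_ext _ _) ≫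
        actCore I M) := by
  letI : Algebra intU.{u} Γ(X, ⊤) := (intCast _).toAlgebra
  letI : Algebra intU.{u} Γ(↑V, ⊤) := (intCast _).toAlgebra
  rw [comp_lift_actCore I V.ι q M]
  set MV : GL (Fin (Nat.card I + 1)) Γ(↑V, ⊤) := Matrix.GeneralLinearGroup.map V.ι.appTop.hom M with hMVdef
  -- RHS: the acted point is `[MV θ]` in the chart `b`
  have hR := lift_actCore_eq_coordPoint I (V.ι ≫ q) MV a b θ ha hθ hθa hb
  -- LHS: `q'|_V` is `[θ']` in the chart `b`
  have hθ'b : IsUnit ((fun i => rs hb'.ge (homRatio (V.ι ≫ q') b i)) b) := by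
    simp only [homRatio_self, map_one]
    exact isUnit_one
  have hL : V.ι ≫ q' = coordPoint intU.{u} (fun i => rs hb'.ge (homRatio (V.ι ≫ q') b i)) b hθ'b :=
    eq_coordPoint_int I (V.ι ≫ q') b hb' _ (fun _ => rfl) hθ'b
  -- `θ' = u⁻¹ • MV θ` with `u = (MV θ)_b`
  have hvec : (fun i => rs hb'.ge (homRatio (V.ι ≫ q') b i)) =
      ((hb.unit⁻¹ : (Γ(↑V, ⊤))ˣ) : Γ(↑V, ⊤)) • ((MV : Matrix _ _ Γ(↑V, ⊤)) *ᵥ θ) := by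
    funext i
    rw [Pi.smul_apply, smul_eq_mul, ← hθ' i, mul_comm (((hb.unit⁻¹ : (Γ(↑V, ⊤))ˣ) : Γ(↑V, ⊤))),
      mul_assoc, IsUnit.mul_val_inv, mul_one]
  have huv : IsUnit ((((hb.unit⁻¹ : (Γ(↑V, ⊤))ˣ) : Γ(↑V, ⊤)) • ((MV : Matrix _ _ Γ(↑V, ⊤)) *ᵥ θ)) b) := by
    rw [← hvec]
    exact hθ'b
  rw [hR, hL, coordPoint_congr hvec b hθ'b huv]
  exact coordPoint_smul _ b hb _ huv

end Chart

/-! ### §2 Generating-sections data: a linear change of the ratios moves `toProj` by the matrix -/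

section Ratios

variable (D D' : GeneratingSections (Fin (Nat.card I + 1)) X)

/-- **A LINEAR CHANGE OF GENERATING SECTIONS MOVES THE MORPHISM TO `𝐏ⁿ_ℤ` BY THE MATRIX** (Hartshorne II Example
7.1.1: «`x'_i = Σ a_{ij} x_j`» read through II Thm. 7.1).  Let `D` («`s_0, …, s_n`») and `D'` («`s'_0, …, s'_n`») be
generating-sections data on `X` and `M ∈ GL_{n+1}(Γ(X, 𝒪_X))`; write `G^a_j := Σ_k M_{jk}|_{U a} · (s_k/s_a)`
(«`s'_j / s_a`»).  If `U a ∩ U' b ⊆ X_{G^a_b}` and `(s'_i/s'_b) · G^a_b = G^a_i` on `U a ∩ U' b` — the ratios of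
`D'` are those of the `M`-transformed sections — then `toProj D' = M • toProj D`, the acted point in the tree's
`S`-free spelling `⟨X → Spec Γ(X, 𝒪_X), q⟩ ≫ actCore M` (★ `Morphisms/ProjectiveFrameLocusLinearInvariance`).  Proof:
equality of morphisms is local on `X`; on `U a ∩ U' b` both sides lie in the chart `D₊(x_b)` with the same
coordinates (§1, ★ `homRatio_toProj`). [cite: Hartshorne1977, II Thm. 7.1 (b)] [cite: Hartshorne1977, II Example 7.1.1 (p. 151)] -/
theorem toProj_eq_lift_actCore_toProj
    (hU : ∀ a b, D.U a ⊓ D'.U b ≤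
      X.basicOpen (∑ k, rs (le_top : D.U a ≤ ⊤) ((M : Matrix _ _ Γ(X, ⊤)) b k) * D.ratio a k))
    (hM : ∀ a b i,
      rs (inf_le_right : D.U a ⊓ D'.U b ≤ D'.U b) (D'.ratio b i) *
          rs (inf_le_left : D.U a ⊓ D'.U b ≤ D.U a)
            (∑ k, rs (le_top : D.U a ≤ ⊤) ((M : Matrix _ _ Γ(X, ⊤)) b k) * D.ratio a k) =
        rs (inf_le_left : D.U a ⊓ D'.U b ≤ D.U a)
          (∑ k, rs (le_top : D.U a ≤ ⊤) ((M : Matrix _ _ Γ(X, ⊤)) i k) * D.ratio a k))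
    (f : X ⟶ Spec (.of intU.{u})) :
    letI : Algebra intU.{u} Γ(X, ⊤) := (intCast _).toAlgebra
    D'.toProj f =
      (isPullback_projToSpec_projMap_terminal I Γ(X, ⊤)).lift X.toSpecΓ (D.toProj f) (terminal.hom_ext _ _) ≫
        actCore I M := by
  letI : Algebra intU.{u} Γ(X, ⊤) := (intCast _).toAlgebra
  -- equality of morphisms is local on `X`: cover by the `D.U a ⊓ D'.U b`
  have hcov : (⨆ p : Fin (Nat.card I + 1) × Fin (Nat.card I + 1), D.U p.1 ⊓ D'.U p.2) = ⊤ := by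
    rw [← iSup_inf_iSup, D.iSup_U, D'.iSup_U, top_inf_eq]
  refine Scheme.Cover.hom_ext (X.openCoverOfIsOpenCover _ hcov) _ _ fun p => ?_
  obtain ⟨a, b⟩ := p
  change (D.U a ⊓ D'.U b).ι ≫ D'.toProj f = (D.U a ⊓ D'.U b).ι ≫ _
  set W : X.Opens := D.U a ⊓ D'.U b with hWdef
  -- `W` lies in the `a`-chart of `D` and the `b`-chart of `D'`
  have hWa : (⊤ : (W : Scheme.{u}).Opens) ≤ W.ι ⁻¹ᵁ D.U a := top_le_ι_preimage_of_le inf_le_left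
  have hWb : (⊤ : (W : Scheme.{u}).Opens) ≤ W.ι ⁻¹ᵁ D'.U b := top_le_ι_preimage_of_le inf_le_right
  have ha : preU (W.ι ≫ D.toProj f) a = ⊤ := by
    apply top_le_iff.mp
    rw [preU, Scheme.Hom.comp_preimage, D.toProj_preimage_basicOpen f a]
    exact hWa
  have hb' : preU (W.ι ≫ D'.toProj f) b = ⊤ := by
    apply top_le_iff.mp
    rw [preU, Scheme.Hom.comp_preimage, D'.toProj_preimage_basicOpen f b]
    exact hWb
  -- the restriction maps `Γ(X, U a) → Γ(W, 𝒪_W)`, `Γ(X, U' b) → Γ(W, 𝒪_W)`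
  set ρ : Γ(X, D.U a) →+* Γ(↑W, ⊤) := res W.ι (D.U a) hWa with hρdef
  set ρ' : Γ(X, D'.U b) →+* Γ(↑W, ⊤) := res W.ι (D'.U b) hWb with hρ'def
  -- chart coordinates of `q|_W` and `q'|_W`
  have hθ : ∀ i, rs ha.ge (homRatio (W.ι ≫ D.toProj f) a i) = ρ (D.ratio a i) := by
    intro i
    rw [homRatio_comp_eq_appLE (D.toProj f) W.ι a i, homRatio_toProj]
    change ((X.presheaf.map (homOfLE _).op ≫ W.ι.appLE _ _ _) ≫ (W : Scheme.{u}).presheaf.map (homOfLE _).op)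
      (D.ratio a i) = _
    rw [Scheme.Hom.map_appLE, Scheme.Hom.appLE_map]
    rfl
  have hθ' : ∀ i, rs hb'.ge (homRatio (W.ι ≫ D'.toProj f) b i) = ρ' (D'.ratio b i) := by
    intro i
    rw [homRatio_comp_eq_appLE (D'.toProj f) W.ι b i, homRatio_toProj]
    change ((X.presheaf.map (homOfLE _).op ≫ W.ι.appLE _ _ _) ≫ (W : Scheme.{u}).presheaf.map (homOfLE _).op)
      (D'.ratio b i) = _
    rw [Scheme.Hom.map_appLE, Scheme.Hom.appLE_map]
    rfl
  -- the vectors `G j = ∑_k M_{jk}|_{U a} · (s_k/s_a)` on `U a` (`= s'_j / s_a`) and their restrictions to `W`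
  set G : Fin (Nat.card I + 1) → Γ(X, D.U a) :=
    fun j => ∑ k, rs (le_top : D.U a ≤ ⊤) ((M : Matrix _ _ Γ(X, ⊤)) j k) * D.ratio a k with hGdef
  set θ : Fin (Nat.card I + 1) → Γ(↑W, ⊤) := fun i => ρ (D.ratio a i) with hθdef
  have hMW : ∀ j, ((Matrix.GeneralLinearGroup.map W.ι.appTop.hom M : Matrix _ _ Γ(↑W, ⊤)) *ᵥ θ) j = ρ (G j) := by
    intro j
    simp only [hGdef, hθdef, Matrix.mulVec, dotProduct, map_sum, map_mul]
    refine Finset.sum_congr rfl fun k _ => ?_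
    congr 1
    rw [Matrix.GeneralLinearGroup.map_apply, hρdef, res_map W.ι ⊤ le_top hWa (le_top : D.U a ≤ ⊤), res_top]
  have hGb : IsUnit (ρ (G b)) := by
    have h1 := isUnit_rs_of_le_basicOpen (G b) (hU a b)
    have h2 : ρ (G b) = res W.ι W (top_le_ι_preimage_of_le le_rfl) (rs (inf_le_left : W ≤ D.U a) (G b)) :=
      (res_map W.ι (D.U a) hWa (top_le_ι_preimage_of_le le_rfl) (inf_le_left : W ≤ D.U a) (G b)).symm
    rw [h2]
    exact h1.map _
  -- the relation `(s'_i/s'_b) · (s'_b/s_a) = s'_i/s_a` read on `W`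
  have hrel : ∀ i, ρ' (D'.ratio b i) * ρ (G b) = ρ (G i) := by
    intro i
    have h := congrArg (res W.ι W (top_le_ι_preimage_of_le le_rfl)) (hM a b i)
    rw [map_mul, res_map W.ι (D'.U b) hWb _ (inf_le_right : W ≤ D'.U b),
      res_map W.ι (D.U a) hWa _ (inf_le_left : W ≤ D.U a), res_map W.ι (D.U a) hWa _ (inf_le_left : W ≤ D.U a)] at h
    exact h
  have hθa : IsUnit (θ a) := by
    simp only [hθdef, D.ratio_self, map_one]
    exact isUnit_one
  refine ι_comp_eq_ι_comp_lift_actCore_of_chart I M (D.toProj f) (D'.toProj f) a b θ ha hθ hθa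
    (by rw [hMW]; exact hGb) hb' fun i => ?_
  rw [hθ', hMW, hMW]
  exact hrel i

end Ratios

/-! ### §3 Cocycle presentations: a linear change of the COEFFICIENTS moves `toProj` by the matrix -/

section Cocycle

variable {α : Type v} (W : α → X.Opens) (S S' : CocycleSections (Fin (Nat.card I + 1)) W)
  (hcov : ⨆ i, ⨆ x, X.basicOpen (S.coeff i x) = ⊤) (hcov' : ⨆ i, ⨆ x, X.basicOpen (S'.coeff i x) = ⊤)

/-- **Cocycle form**: if two families of local coefficients `c`, `c'` on the same trivialising opens `W x` (★
`CocycleSections`; the coefficients of sections `t_i`, `t'_i` of ONE trivialised line bundle) are related by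
`c' j x = Σ_k M_{jk}|_{W x} · c k x` for an `M ∈ GL_{n+1}(Γ(X, 𝒪_X))` — i.e. `t'_j = Σ_k M_{jk} t_k` — then the
morphism to `𝐏ⁿ_ℤ` of the `t'` is `M •` the morphism of the `t` (Hartshorne II Example 7.1.1 through II Thm. 7.1;
on `X_{c a x} ∩ X_{c' b x}` both sides lie in `D₊(x_b)` with coordinates `c' i x / c' b x`, §1).
[cite: Hartshorne1977, II Thm. 7.1 (b)] [cite: Hartshorne1977, II Example 7.1.1 (p. 151)] -/
theorem toProj_ofCocycleSections_eq_lift_actCore_of_coeff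
    (hS : ∀ j x, S'.coeff j x = ∑ k, rs (le_top : W x ≤ ⊤) ((M : Matrix _ _ Γ(X, ⊤)) j k) * S.coeff k x)
    (f : X ⟶ Spec (.of intU.{u})) :
    letI : Algebra intU.{u} Γ(X, ⊤) := (intCast _).toAlgebra
    (ofCocycleSections W S' hcov').toProj f =
      (isPullback_projToSpec_projMap_terminal I Γ(X, ⊤)).lift X.toSpecΓ ((ofCocycleSections W S hcov).toProj f)
          (terminal.hom_ext _ _) ≫ actCore I M := by
  letI : Algebra intU.{u} Γ(X, ⊤) := (intCast _).toAlgebra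
  set D := ofCocycleSections W S hcov with hDdef
  set D' := ofCocycleSections W S' hcov' with hD'def
  -- cover by the `X_{c a x} ∩ X_{c' b x}` (ONE trivialisation for both)
  have hcov3 : (⨆ p : Fin (Nat.card I + 1) × Fin (Nat.card I + 1) × α,
      X.basicOpen (S.coeff p.1 p.2.2) ⊓ X.basicOpen (S'.coeff p.2.1 p.2.2)) = ⊤ := by
    apply top_le_iff.mp
    intro p _
    have hp : p ∈ (⨆ i, ⨆ x, X.basicOpen (S.coeff i x)) := by rw [hcov]; trivial
    obtain ⟨a, ha⟩ := Opens.mem_iSup.mp hp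
    obtain ⟨x, hx⟩ := Opens.mem_iSup.mp ha
    have hp' : p ∈ (⨆ i, ⨆ y, X.basicOpen (S'.coeff i y)) := by rw [hcov']; trivial
    obtain ⟨b, hb⟩ := Opens.mem_iSup.mp hp'
    obtain ⟨y, hy⟩ := Opens.mem_iSup.mp hb
    have hbx : p ∈ X.basicOpen (S'.coeff b x) := S'.locus b y x ⟨hy, X.basicOpen_le _ hx⟩
    exact Opens.mem_iSup.mpr ⟨(a, b, x), ⟨hx, hbx⟩⟩
  refine Scheme.Cover.hom_ext (X.openCoverOfIsOpenCover _ hcov3) _ _ fun p => ?_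
  obtain ⟨a, b, x⟩ := p
  change (X.basicOpen (S.coeff a x) ⊓ X.basicOpen (S'.coeff b x)).ι ≫ D'.toProj f =
    (X.basicOpen (S.coeff a x) ⊓ X.basicOpen (S'.coeff b x)).ι ≫ _
  set V : X.Opens := X.basicOpen (S.coeff a x) ⊓ X.basicOpen (S'.coeff b x) with hVdef
  have hVa : V ≤ D.U a := inf_le_left.trans (basicOpen_le_ofCocycleSections_U W S hcov a x)
  have hVb : V ≤ D'.U b := inf_le_right.trans (basicOpen_le_ofCocycleSections_U W S' hcov' b x)
  have hVx : V ≤ W x := inf_le_left.trans (X.basicOpen_le _)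
  have hWa : (⊤ : (V : Scheme.{u}).Opens) ≤ V.ι ⁻¹ᵁ D.U a := top_le_ι_preimage_of_le hVa
  have hWb : (⊤ : (V : Scheme.{u}).Opens) ≤ V.ι ⁻¹ᵁ D'.U b := top_le_ι_preimage_of_le hVb
  have hWx : (⊤ : (V : Scheme.{u}).Opens) ≤ V.ι ⁻¹ᵁ W x := top_le_ι_preimage_of_le hVx
  have ha : preU (V.ι ≫ D.toProj f) a = ⊤ := by
    apply top_le_iff.mp
    rw [preU, Scheme.Hom.comp_preimage, D.toProj_preimage_basicOpen f a]
    exact hWa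
  have hb' : preU (V.ι ≫ D'.toProj f) b = ⊤ := by
    apply top_le_iff.mp
    rw [preU, Scheme.Hom.comp_preimage, D'.toProj_preimage_basicOpen f b]
    exact hWb
  set ρ : Γ(X, D.U a) →+* Γ(↑V, ⊤) := res V.ι (D.U a) hWa with hρdef
  set ρ' : Γ(X, D'.U b) →+* Γ(↑V, ⊤) := res V.ι (D'.U b) hWb with hρ'def
  set γ : Γ(X, W x) →+* Γ(↑V, ⊤) := res V.ι (W x) hWx with hγdef
  have hθ : ∀ i, rs ha.ge (homRatio (V.ι ≫ D.toProj f) a i) = ρ (D.ratio a i) := by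
    intro i
    rw [homRatio_comp_eq_appLE (D.toProj f) V.ι a i, homRatio_toProj]
    change ((X.presheaf.map (homOfLE _).op ≫ V.ι.appLE _ _ _) ≫ (V : Scheme.{u}).presheaf.map (homOfLE _).op)
      (D.ratio a i) = _
    rw [Scheme.Hom.map_appLE, Scheme.Hom.appLE_map]
    rfl
  have hθ' : ∀ i, rs hb'.ge (homRatio (V.ι ≫ D'.toProj f) b i) = ρ' (D'.ratio b i) := by
    intro i
    rw [homRatio_comp_eq_appLE (D'.toProj f) V.ι b i, homRatio_toProj]
    change ((X.presheaf.map (homOfLE _).op ≫ V.ι.appLE _ _ _) ≫ (V : Scheme.{u}).presheaf.map (homOfLE _).op)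
      (D'.ratio b i) = _
    rw [Scheme.Hom.map_appLE, Scheme.Hom.appLE_map]
    rfl
  -- the local generators restricted to `V` are units
  have hca : IsUnit (γ (S.coeff a x)) := by
    have h1 := isUnit_rs_of_le_basicOpen (S.coeff a x) (inf_le_left : V ≤ X.basicOpen (S.coeff a x))
    have h2 : γ (S.coeff a x) = res V.ι V (top_le_ι_preimage_of_le le_rfl) (rs hVx (S.coeff a x)) :=
      (res_map V.ι (W x) hWx (top_le_ι_preimage_of_le le_rfl) hVx (S.coeff a x)).symm
    rw [h2]
    exact h1.map _
  have hcb : IsUnit (γ (S'.coeff b x)) := by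
    have h1 := isUnit_rs_of_le_basicOpen (S'.coeff b x) (inf_le_right : V ≤ X.basicOpen (S'.coeff b x))
    have h2 : γ (S'.coeff b x) = res V.ι V (top_le_ι_preimage_of_le le_rfl) (rs hVx (S'.coeff b x)) :=
      (res_map V.ι (W x) hWx (top_le_ι_preimage_of_le le_rfl) hVx (S'.coeff b x)).symm
    rw [h2]
    exact h1.map _
  -- the defining local formulas `(t_j/t_a) · c a x = c j x`, `(t'_j/t'_b) · c' b x = c' j x` read on `V`
  have hDa : ∀ j, ρ (D.ratio a j) * γ (S.coeff a x) = γ (S.coeff j x) := by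
    intro j
    have h := congrArg (res V.ι (X.basicOpen (S.coeff a x)) (top_le_ι_preimage_of_le inf_le_left))
      (ofCocycleSections_ratio_res_mul W S hcov a j x)
    rw [map_mul, res_map V.ι (D.U a) hWa _ (basicOpen_le_ofCocycleSections_U W S hcov a x),
      res_map V.ι (W x) hWx _ (X.basicOpen_le _), res_map V.ι (W x) hWx _ (X.basicOpen_le _)] at h
    exact h
  have hDb : ∀ j, ρ' (D'.ratio b j) * γ (S'.coeff b x) = γ (S'.coeff j x) := by
    intro j
    have h := congrArg (res V.ι (X.basicOpen (S'.coeff b x)) (top_le_ι_preimage_of_le inf_le_right))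
      (ofCocycleSections_ratio_res_mul W S' hcov' b j x)
    rw [map_mul, res_map V.ι (D'.U b) hWb _ (basicOpen_le_ofCocycleSections_U W S' hcov' b x),
      res_map V.ι (W x) hWx _ (X.basicOpen_le _), res_map V.ι (W x) hWx _ (X.basicOpen_le _)] at h
    exact h
  -- `(M|_V θ)_j · c a x = c' j x` on `V`
  set θ : Fin (Nat.card I + 1) → Γ(↑V, ⊤) := fun i => ρ (D.ratio a i) with hθdef
  have hMV : ∀ j, ((Matrix.GeneralLinearGroup.map V.ι.appTop.hom M : Matrix _ _ Γ(↑V, ⊤)) *ᵥ θ) j *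
      γ (S.coeff a x) = γ (S'.coeff j x) := by
    intro j
    rw [hS j x]
    simp only [hθdef, Matrix.mulVec, dotProduct, map_sum, map_mul, Finset.sum_mul]
    refine Finset.sum_congr rfl fun k _ => ?_
    rw [mul_assoc, hDa k, Matrix.GeneralLinearGroup.map_apply, hγdef,
      res_map V.ι ⊤ le_top hWx (le_top : W x ≤ ⊤), res_top]
  have hθa : IsUnit (θ a) := by
    simp only [hθdef, D.ratio_self, map_one]
    exact isUnit_one
  have hb : IsUnit (((Matrix.GeneralLinearGroup.map V.ι.appTop.hom M : Matrix _ _ Γ(↑V, ⊤)) *ᵥ θ) b) := by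
    refine isUnit_of_mul_isUnit_left (y := γ (S.coeff a x)) ?_
    rw [hMV b]
    exact hcb
  refine ι_comp_eq_ι_comp_lift_actCore_of_chart I M (D.toProj f) (D'.toProj f) a b θ ha hθ hθa hb hb' fun i => ?_
  -- cancel the unit `c a x|_V`: `θ'_i (Mθ)_b c_a = θ'_i c'_b = c'_i = (Mθ)_i c_a`
  refine (hca.mul_left_inj).mp ?_
  rw [mul_assoc, hMV b, hMV i, hθ', hDb i]

end Cocycle

/-! ### §4 Line bundles with a frame system: a linear change of the SECTIONS moves `toProj` by the matrix -/

section FrameSystem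

open Literature.AlgebraicGeometry.Modules

variable {E : X.Modules} (F : FrameSystem E) (h1 : ∀ x, F.rank x = 1)
  (t t' : Fin (Nat.card I + 1) → Γ(E, ⊤))

/-- The local coefficients of `t'_j = Σ_k M_{jk} t_k` are `Σ_k M_{jk}|_{U_x} · (coefficient of t_k)` (coordinates in a
frame are `𝒪_X`-linear). [cite: Hartshorne1977, II proof of Thm. 7.1] -/
theorem coeffAt_eq_sum_of_eq_sum_smul (ht' : ∀ j, t' j = ∑ k, ((M : Matrix _ _ Γ(X, ⊤)) j k) • t k)
    (j : Fin (Nat.card I + 1)) (x : X) :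
    coeffAt F h1 t' j x = ∑ k, rs (le_top : F.U x ≤ ⊤) ((M : Matrix _ _ Γ(X, ⊤)) j k) * coeffAt F h1 t k x := by
  simp only [coeffAt, ht' j, map_sum, Scheme.Modules.map_smul, coord_sum, coord_smul]

/-- **Line-bundle form** (the currency of the F-6 / F-8 files of cell hodgecm-mathlib: ★ `IsFrameRigidification`, ★
(FS-a) `ProjectiveOfPushforwardFrame`): for a module `E` with a rank-one frame system `F` and global sections `t_i`,
`t'_i` with `t'_j = Σ_k M_{jk} t_k`, `M ∈ GL_{n+1}(Γ(X, 𝒪_X))`, both families generating, the morphism to `𝐏ⁿ_ℤ` of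
the `t'` is `M •` that of the `t` (Hartshorne II Example 7.1.1: an invertible matrix acts on `𝐏ⁿ` by
`x'_i = Σ a_{ij} x_j`). [cite: Hartshorne1977, II Thm. 7.1 (b)] [cite: Hartshorne1977, II Example 7.1.1 (p. 151)] -/
theorem toProj_ofFrameSystem_eq_lift_actCore_of_eq_sum_smul
    (ht' : ∀ j, t' j = ∑ k, ((M : Matrix _ _ Γ(X, ⊤)) j k) • t k)
    (hcov : ⨆ i, ⨆ x, X.basicOpen ((CocycleSections.ofFrameSystem F h1 t).coeff i x) = ⊤)
    (hcov' : ⨆ i, ⨆ x, X.basicOpen ((CocycleSections.ofFrameSystem F h1 t').coeff i x) = ⊤)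
    (f : X ⟶ Spec (.of intU.{u})) :
    letI : Algebra intU.{u} Γ(X, ⊤) := (intCast _).toAlgebra
    (ofCocycleSections F.U (CocycleSections.ofFrameSystem F h1 t') hcov').toProj f =
      (isPullback_projToSpec_projMap_terminal I Γ(X, ⊤)).lift X.toSpecΓ
          ((ofCocycleSections F.U (CocycleSections.ofFrameSystem F h1 t) hcov).toProj f) (terminal.hom_ext _ _) ≫
        actCore I M :=
  toProj_ofCocycleSections_eq_lift_actCore_of_coeff I M F.U (CocycleSections.ofFrameSystem F h1 t)
    (CocycleSections.ofFrameSystem F h1 t') hcov hcov'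
    (fun j x => by
      rw [CocycleSections.ofFrameSystem_coeff, CocycleSections.ofFrameSystem_coeff]
      exact coeffAt_eq_sum_of_eq_sum_smul I M F h1 t t' ht' j x) f

end FrameSystem

end Literature.AlgebraicGeometry.Motives.GeneratingSections

end
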